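import Summits.PneNP.PneNP.Theorems.PhaseTwinsNoFBPPApproxAboveUniquenessCalibration
import Literature.Computability.Complexity.EquivalenceProblemsCollapseProofs
import Literature.Computability.Complexity.NPClosureProofs
import Literature.Computability.Complexity.BPClosureProofs
import Literature.Computability.Complexity.CookLevinSAT
import Literature.Computability.Complexity.NegCNFTranscoder
import Literature.Computability.Cryptography.PseudorandomGeneratorsStretchOne

/-!
# Two more equivalent forms and one more feeder for crux stmt-PneNP-2717 (`NoFBPPApproxAboveUniqueness` =: X)

Complement (lead prover-line-stmt-PneNP-2717-c1-0, line `SketchIdeator1`) to the landed calibration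
`X ↔ ¬(NP ⊆ BPP)` (`…Calibration.lean`, p93858) and conjecture web (`…ConjectureWeb.lean`, p96055: `X ↔ NP ≠ RP`,
`OWFExist → X`, `NPNotSubsetPPoly → X`, `X → PneNP`). Kernel-checked, fact-free compositions with PROVED tree theorems:

* `X ↔ PH ≠ BPP` — Zachos 1988 (`NP ⊆ BPP → PH ⊆ BPP`) with Sipser–Gács–Lautemann `BPP ⊆ Σ₂ᵖ`
  (`PH_eq_BPP_of_NP_subset_BPP`); conversely `NP ⊆ PH` (`NP_subset_PH_holds`);
* `X ↔ SAT ∉ BPP` — Cook–Levin (`SAT_isNPHard_holds`, `SAT_mem_NP_holds`) and closure of `BPP` under Karp reductions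
  (`NP_subset_BPP_of_isNPHard_of_mem_BPP`): the crux is ONE concrete membership question;
* `PRGExist → X` — pseudorandom generators (`NP_not_subset_BPP_of_PRGExist`, through `OWFExist`).
-/

set_option linter.dupNamespace false

namespace Summit.PneNP.PneNP.Theorems.NoFBPPApproxAboveUniqueness

open Literature.Computability.Complexity
open Summit.PneNP.PneNP.Theses.PhaseTwins (NoFBPPApproxAboveUniqueness)

/-- **`X ↔ PH ≠ BPP`** (`NP ⊆ BPP ↔ PH = BPP`: Zachos + Sipser–Gács–Lautemann one way, `NP ⊆ PH` the other).
[cite: FortnowGrochow2011, Cor. 4.4 (proof)] -/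
theorem noFBPPApproxAboveUniqueness_iff_PH_ne_BPP : NoFBPPApproxAboveUniqueness ↔ PH ≠ BPP := by
  rw [noFBPPApproxAboveUniqueness_iff_not_NP_subset_BPP]
  exact ⟨fun h hEq => h (hEq ▸ NP_subset_PH_holds), fun h hNP => h (PH_eq_BPP_of_NP_subset_BPP hNP)⟩

/-- **`X ↔ SAT ∉ BPP`** (`SAT` is NP-hard and in `NP`, both proved in the tree; `BPP` is closed under Karp
reductions). [cite: AroraBarakCC2009, Lemma 2.11] -/
theorem noFBPPApproxAboveUniqueness_iff_SAT_not_mem_BPP : NoFBPPApproxAboveUniqueness ↔ SAT ∉ BPP := by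
  rw [noFBPPApproxAboveUniqueness_iff_not_NP_subset_BPP]
  exact ⟨fun h hSAT => h (NP_subset_BPP_of_isNPHard_of_mem_BPP SAT_isNPHard_holds hSAT),
    fun h hNP => h (hNP SAT_mem_NP_holds)⟩

/-- **Pseudorandom generators give the crux** (`PRGExist → OWFExist → NP ⊄ BPP`, proved in the tree).
[cite: Goldreich2001, §3.3.6] -/
theorem noFBPPApproxAboveUniqueness_of_PRGExist (h : Literature.Computability.Cryptography.PRGExist) :
    NoFBPPApproxAboveUniqueness :=
  noFBPPApproxAboveUniqueness_of_not_NP_subset_BPP (Literature.Computability.Cryptography.NP_not_subset_BPP_of_PRGExist h)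

end Summit.PneNP.PneNP.Theorems.NoFBPPApproxAboveUniqueness
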